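/-
Copyright (c) 2026 the pub-hodgecm2 formalisation cell (harness21).  New file.
Origin: seat `prover-pub-hodgecm-own-htheta-g10-0` (unit pub-hodgecm-own-htheta, gen 10; OWNER of the item-(vi) lineage, S2-CRUX owner,
Δ2-bridge contributor), 2026-08-23 — Δ2 BRIDGE §3 R2 L2.1 AT THE ONE-OBJECT REST: every `restOne` ([Liu2021] Def. 4.5 (2) ∕ 4.16 ∕ Rem. 4.17,
`AppendixC/RestOne.lean`) whose theta-side carriers `Eps ∕ epsOf ∕ Chi ∕ omega ∕ rho` come from a μ-UNIFORM family (`UniformOmega`,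
`AppendixC/Prop413DataOfTower.lean`) IS `U.rest` of a tail, BY `rfl`; hence the Δ2 junctions' multiplicity pin `hmultD` at such a rest is
DERIVED from the LITERAL cite `Prop413AsPrinted (U.prop413Data H)` of [Liu2021, Prop. 4.13] AS PRINTED.  The model's generic Liu rests
(`Model.restOfCharD ∕ restOfCharRep`, `Summits/HodgeConjecture/CorCM/B01/Transposition/Item6RestOfChar*.lean`) are `restOne`s of exactly this
shape.  KERNEL only (two theorems by `rfl` ∕ one application, one `def` assembling a record); count-neutral; HC_CM is NOT proved;
«Δ2 BRIDGE CLOSED» is NOT claimed.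
-/
import Literature.NumberTheory.Automorphic.Liu2021.AppendixC.RestOne
import Literature.NumberTheory.Automorphic.Liu2021.AppendixC.Prop413DataOfTower
import HarnessLib

set_option autoImplicit false

/-!
# [Liu2021, Prop. 4.13] AS PRINTED at the one-object rests: `restOne` over μ-uniform carriers is `UniformOmega.rest`

For an Appendix-C datum `C : Sec42Data P5 isotropicAt`, a μ-uniform family of Def. 4.11 carriers `U : UniformOmega C` and the data of the
one-object rest at a conjugate-symplectic weight-one `μ` — `(φ, ι)`, `hμ`, `hw`, Def. 4.5 carriers `Car` and a Hecke action `rhoΩ` on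
`ΩOne C φ ι hμ hw Car` (`AppendixC/RestOne.lean`):

* `restTailOne φ ι hμ hw Car rhoΩ : RestTail C μ hμ` — the tail `⟨hw, ObjOne, AμOne, ΩOne, rhoΩ, resOne, resOne_pull⟩`;
* `UniformOmega.restOne_eq_rest` — `restOne C φ ι hμ hw Car U.Eps U.epsOf U.Chi (U.omega μ hμ) (U.rho μ hμ) rhoΩ = U.rest (restTailOne …)`
  (`rfl`: the same `Thm418Rest.mk` application, FIELDS MATCH);
* `UniformOmega.toThm418Data_restOne_eq` — the same after `toThm418Data C` (`rfl`);
* `UniformOmega.rank_intertwiningMap_rhoAt_restOne_le_one_of_prop413AsPrinted` — THE PAY-OFF at `restOne`: for every `ℂ[C.G]`-module `H`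
  (the consumer's tower for `H¹_{B,ι}(A_∞, ℂ)`), `Prop413AsPrinted (U.prop413Data H)` + `3 ≤ n` + Def. 4.11 adjectives (`h411`) + pairwise
  non-isomorphy (`hsep`, Thm. 4.18 (2) ∕ Lem. D.1 (3)) + one compact open subgroup (`hK`) ⟹
  `dim_ℂ Hom_{ℂ[C.G]}(ω_i, H) ≤ 1` for every admissible index `i` of `toThm418Data C (restOne … U.Eps U.epsOf U.Chi (U.omega μ hμ) (U.rho μ hμ) rhoΩ)`
  — the junctions' `hmultD μ hμ hg i` whenever `R μ hμ hg` is such a `restOne` (the model's `restOfCharD … μ hμ hw` is, with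
  `U := ⟨Eps, epsOf, Chi, fun μ hμ => omega…(hsChiD … (toHeckeCharacter F μ) …), fun μ hμ => rho … ιV⟩`), with NO proof-sentence cite and no
  `hirrD ∕ hnvD` binder.

## References
* [Liu2021] Y. Liu, *Fourier–Jacobi cycles and arithmetic relative trace formula*, Camb. J. Math. 9 (2021) 1–147 = arXiv:2102.11518 —
  Prop. 4.13 (FJcycle.tex ll. 2113–2119), Def. 4.5 (2) (ll. 1944–1958), Def. 4.11 (ll. 2083–2097), Def. 4.12, Def. 4.16 (l. 2219), Rem. 4.17,
  Thm. 4.18 (2), App. D Lem. D.1 (3).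
* Tree: `AppendixC/RestOne.lean` (`restOne`, `ObjOne`, `AμOne`, `ΩOne`, `resOne`, `resOne_pull`), `AppendixC/Prop413DataOfTower.lean`
  (`UniformOmega`, `RestTail`, `UniformOmega.rest ∕ prop413Data ∕ rank_intertwiningMap_rhoAt_rest_le_one_of_prop413AsPrinted`),
  `Liu2021/Prop413MultLeOneOfAsPrinted.lean` (Schur engine).

HC_CM is NOT proved.
-/

noncomputable section

open NumberField

namespace Literature.NumberTheory.Automorphic.Liu2021.AppendixC

open Literature.NumberTheory.Automorphic.Liu2021.AppendixC.RestOne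
open Literature.RepresentationTheory

variable {F E : Type} [Field F] [NumberField F] [IsTotallyReal F] [Field E] [NumberField E] [Algebra F E]
  [IsTotallyComplex E] [Algebra.IsQuadraticExtension F E] [IsCMField E]
variable {P5 : PropC5Data F E} {isotropicAt : ℕ → Prop} {C : Sec42Data P5 isotropicAt} (U : UniformOmega C)
variable {L : Type} [Field L] [NumberField L] [IsGalois ℚ L] (φ : E →ₐ[ℚ] L) (ι : L →+* ℂ)
variable {μ : IdeleClassGroup E →ₜ* Circle} (hμ : IdeleClassGroup.IsConjugateSymplectic E μ)
  (hw : IdeleClassGroup.HasWeight E μ 1) (Car : Def45.Carriers E μ)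

/-- **The tail of the one-object rest** at `(φ, ι, μ, Car, rhoΩ)`: weight one, `ObjOne ∕ AμOne` ([Liu2021] Def. 4.5 (2): the chosen
`D_μ ∈ 𝒜(μ)` and its `A_μ`), `ΩOne` with the Hecke action `rhoΩ` (Def. 4.16, Rem. 4.17) and `resOne ∕ resOne_pull` (§4.2).  Nothing asserted.
[cite: Liu2021, Def. 4.5 (2) (ll. 1944–1958), Def. 4.16 (l. 2219), Rem. 4.17] -/
def restTailOne (rhoΩ : Representation (fieldOfValues E μ) C.G (ΩOne C φ ι hμ hw Car)) : RestTail C μ hμ where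
  hasWeight_one := hw
  Obj := ObjOne φ ι hμ hw Car
  Aμ := AμOne φ ι hμ hw Car
  Ω := ΩOne C φ ι hμ hw Car
  rhoΩ := rhoΩ
  res := resOne C φ ι hμ hw Car
  res_pull f D t := resOne_pull C φ ι hμ hw Car f D t

namespace UniformOmega

/-- **FIELDS MATCH** — the one-object rest over μ-UNIFORM theta-side carriers IS the rest assembled from `U` and the tail `restTailOne`,
by `rfl` (both are the same `Thm418Rest.mk` application). [cite: Liu2021, Def. 4.11, Def. 4.16, Thm. 4.18] -/
theorem restOne_eq_rest (rhoΩ : Representation (fieldOfValues E μ) C.G (ΩOne C φ ι hμ hw Car)) :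
    restOne C φ ι hμ hw Car U.Eps U.epsOf U.Chi (U.omega μ hμ) (U.rho μ hμ) rhoΩ = U.rest (restTailOne φ ι hμ hw Car rhoΩ) :=
  rfl

/-- … hence the same [Liu2021, Thm. 4.18] datum (`rfl`). [cite: Liu2021, Thm. 4.18 (ll. 2232–2245)] -/
theorem toThm418Data_restOne_eq (rhoΩ : Representation (fieldOfValues E μ) C.G (ΩOne C φ ι hμ hw Car)) :
    toThm418Data C (restOne C φ ι hμ hw Car U.Eps U.epsOf U.Chi (U.omega μ hμ) (U.rho μ hμ) rhoΩ) =
      toThm418Data C (U.rest (restTailOne φ ι hμ hw Car rhoΩ)) :=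
  rfl

/-- **THE MULTIPLICITY PIN `hmultD` AT THE ONE-OBJECT RESTS, from [Liu2021, Prop. 4.13] AS PRINTED.**  For every `ℂ[C.G]`-module `H` (the
consumer's tower for `H¹_{B,ι}(A_∞, ℂ)`): the LITERAL cite `h413 : Prop413AsPrinted (U.prop413Data H)` («there is an isomorphism
`H ≃ ⊕_{(μ,ε,χ)} ω(μ,ε,χ)` of `ℂ[𝔾(𝔸_F^∞)]`-modules over all adèlic oscillator triples with `μ` of weight one and `ε` μ-admissible»,
ll. 2113–2119, read at the one embedding of interest), `3 ≤ n`, Def. 4.11's adjectives of the summands (`h411`), their pairwise non-isomorphy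
(`hsep`: Thm. 4.18 (2) ∕ App. D Lem. D.1 (3)) and one compact open subgroup (`hK`) give `dim_ℂ Hom_{ℂ[C.G]}(ω_i, H) ≤ 1` for every admissible
index `i` of Thm. 4.18's datum at the rest `restOne C φ ι hμ hw Car U.Eps U.epsOf U.Chi (U.omega μ hμ) (U.rho μ hμ) rhoΩ` — the Δ2 junctions'
binder `hmultD` at every such rest, by Schur's lemma (`UniformOmega.rank_intertwiningMap_rhoAt_rest_le_one_of_prop413AsPrinted`) along
`restOne_eq_rest`; no proof-sentence cite (l. 2145), no `hirrD ∕ hnvD`.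
[cite: Liu2021, Prop. 4.13 (ll. 2113–2119); Def. 4.11; Thm. 4.18 (2); App. D Lemma D.1 (3)] -/
theorem rank_intertwiningMap_rhoAt_restOne_le_one_of_prop413AsPrinted (H : Type) [AddCommGroup H] [Module ℂ H]
    [Module (MonoidAlgebra ℂ C.G) H] [IsScalarTower ℂ (MonoidAlgebra ℂ C.G) H]
    (h413 : Prop413AsPrinted (U.prop413Data H)) (hn : 3 ≤ P5.n) (τ' : E →+* ℂ)
    (h411 : ∀ t : (U.prop413Data H).AdmTriple, IsIrreducibleOrZero ((U.prop413Data H).rhoAt t) ∧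
      IsSmoothRep ((U.prop413Data H).rhoAt t) ∧ IsAdmissibleRep ((U.prop413Data H).rhoAt t))
    (hsep : ∀ s t : (U.prop413Data H).AdmTriple, Nontrivial ((U.prop413Data H).omegaAt s) →
      (∃ f : (U.prop413Data H).omegaAt s ≃ₗ[ℂ] (U.prop413Data H).omegaAt t,
        ∀ (g : C.G) (v : (U.prop413Data H).omegaAt s), f ((U.prop413Data H).rhoAt s g v) = (U.prop413Data H).rhoAt t g (f v)) →
      s = t)
    (hK : ∃ K : Subgroup C.G, IsOpenCompact K)
    (rhoΩ : Representation (fieldOfValues E μ) C.G (ΩOne C φ ι hμ hw Car))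
    (i : (toThm418Data C (restOne C φ ι hμ hw Car U.Eps U.epsOf U.Chi (U.omega μ hμ) (U.rho μ hμ) rhoΩ)).AdmIndex) :
    Module.rank ℂ (Representation.IntertwiningMap
      ((toThm418Data C (restOne C φ ι hμ hw Car U.Eps U.epsOf U.Chi (U.omega μ hμ) (U.rho μ hμ) rhoΩ)).rhoAt i)
      (Representation.ofModule' (k := ℂ) (G := C.G) H)) ≤ 1 :=
  U.rank_intertwiningMap_rhoAt_rest_le_one_of_prop413AsPrinted H h413 hn τ' h411 hsep hK (restTailOne φ ι hμ hw Car rhoΩ) i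

end UniformOmega

end Literature.NumberTheory.Automorphic.Liu2021.AppendixC

end
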